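import Summits.HodgeConjecture.CorCM.Census.CentralSquaresOrbitFace
import Summits.HodgeConjecture.CorCM.Census.CentralSquaresNearLatticePow

/-!
# The square-central class, XXXVI: CLOSURE FROM CONSECUTIVE SUMS — `4Y_h`, `4Y'_k` from the orbit faces and the transversal relations

COR-CM (cell `pub-hodgecm2`), count-neutral kernel combinatorics by the binder seat b09 (gen 47; lane SQUARE-CENTRAL CLASS, part XXXVI), on part XXV
(`rel_transversal_mem'`, `relc_mem'` are the intended sources of the hypotheses) and part XXIV (`residual_closure_four_pow`, applied in part XXXVII),
BY NAME.  Theorems only: no definition, no `decide`, no certificate, no named fact, no `sorry`.  HONEST FRAMING: `HC_CM` is NOT proved, here or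
anywhere in the tree; nothing here is a period or a headline.

THE ALGEBRA OF THE KERNEL-FOUR ROWS (design note `KERNEL-FOUR.md`, gen 47; verified WITHOUT any translate in all 28 configurations of order 32 with
a reflection lift of order 4: `Rᶜ`(σ-transversals) + `R`(σ'-transversals) + consecutive `Y'`-sums (σ) + consecutive `Y`-sums (σ') has full rank
`18` with Smith invariants `[4,4,4,4]`).  For a swap whose place permutation `σ` has a `4`-cycle `h₀ → h₁ → h₂ → h₃ → h₀` inside `𝓗`:
* §1 `four_smul_mem_of_consecutive`: `y₀ + y₁, y₁ + y₂, y₂ + y₃, y₀ − y₁ + y₂ − y₃ ∈ L ⟹ 4y₀ ∈ L` (`4y₀ = alt + 3P₀ − 2P₁ + P₂`).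
* §2 `rel_sub_rel_cycle` / `relc_sub_relc_cycle`: for `T ⊆ 𝓗` through `h₀, h₂` and avoiding `h₁, h₃`, `R(T) − R((T ∖ {h₀,h₂}) ∪ {h₁,h₃}) =
  Y_{h₀} − Y_{h₁} + Y_{h₂} − Y_{h₃}` EXACTLY; the same for `Rᶜ` on `T₀ ∩ T₁` with `Y'`.
* §3 `transversal_cycle_swap`: if `T` is a transversal of the swap (`t ∈ T ↔ σt ∉ T`) through `h₀, h₂`, so is `(T ∖ {h₀,h₂}) ∪ {h₁,h₃}` (same size,
  still inside the ambient set) — the place permutation has unique preimages on representatives (`eq_of_swap_rel_eq`).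
* §4 **`four_smul_Y_mem_of_cycle`**, **`four_smul_Y'_mem_of_cycle`**: if `L ∋ R(T)` for every transversal `T ⊆ 𝓗` of size `m` (resp. `Rᶜ(T')` for
  every transversal `T' ⊆ T₀ ∩ T₁`), one transversal exists, and `L` contains the consecutive sums `Y_h + Y_{σh}` on the cycle (resp. `Y'_k + Y'_{σk}`),
  then `4Y_{h₀} ∈ L` (resp. `4Y'_{k₀} ∈ L`) — the inputs of part XXIVʼs `residual_closure_four_pow` with `k = 2`.

## References
* [Pohlmann1968] H. Pohlmann, Algebraic cycles on abelian varieties of complex multiplication type, Ann. of Math. 88 (1968), Thm 1.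
-/

namespace Summit.HodgeConjecture.CorCM.Census.CentralSquares

open Finset
open scoped symmDiff
open Summit.HodgeConjecture.CorCM.Prior.AllgGroup.RfwfAllgGroup
open Summit.HodgeConjecture.CorCM.Census.BlockParity
open Summit.HodgeConjecture.CorCM.Census.Coinvariant
open Summit.HodgeConjecture.CorCM.Census.TwistGeneration
open Summit.HodgeConjecture.CorCM.Census.BaseBlock
open Summit.HodgeConjecture.CorCM.Census.CoverClosure

noncomputable section

/-! ## §1 Four times a class from three consecutive sums and the alternating sum -/

/-- **`4y₀ ∈ L`** from `y₀ + y₁`, `y₁ + y₂`, `y₂ + y₃`, `y₀ − y₁ + y₂ − y₃ ∈ L`: `4y₀ = (y₀ − y₁ + y₂ − y₃) + 3(y₀ + y₁) − 2(y₁ + y₂) + (y₂ + y₃)`.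
[folklore] -/
theorem four_smul_mem_of_consecutive {M : Type*} [AddCommGroup M] (L : Submodule ℤ M) {y₀ y₁ y₂ y₃ : M}
    (h01 : y₀ + y₁ ∈ L) (h12 : y₁ + y₂ ∈ L) (h23 : y₂ + y₃ ∈ L) (halt : y₀ - y₁ + y₂ - y₃ ∈ L) : (4 : ℤ) • y₀ ∈ L := by
  have e : (4 : ℤ) • y₀ = (y₀ - y₁ + y₂ - y₃) + (3 : ℤ) • (y₀ + y₁) - (2 : ℤ) • (y₁ + y₂) + (y₂ + y₃) := by module
  rw [e]
  exact Submodule.add_mem _ (Submodule.sub_mem _ (Submodule.add_mem _ halt (Submodule.smul_mem _ _ h01)) (Submodule.smul_mem _ _ h12)) h23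

variable {G : Type*} [Group G] [Fintype G] [DecidableEq G] (c : G)

/-! ## §2 Differences of transversal relations along a cycle -/

/-- **`R(T) − R(T') = Y_{h₀} − Y_{h₁} + Y_{h₂} − Y_{h₃}`** for `T ⊆ 𝓗` through `h₀ ≠ h₂` and `T' = (T ∖ {h₀, h₂}) ∪ {h₁, h₃}` with `h₁ ≠ h₃` in
`𝓗 ∖ T` (`R(S) = Σ_{s∈S} [T₀^{(s)}] − Σ_{u ∈ 𝓗∖S} [T₁^{(u)}] − (m−1)(e₀ − e₁)`, `Y_s = (f_s − e₀) + (g_s − e₁)`). [folklore] -/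
theorem rel_sub_rel_cycle (hc2 : c * c = 1) (T₀ T₁ : CMF G c) (m : ℕ) (T : Finset G) (hTH : T ⊆ T₀.1 \ T₁.1) {h₀ h₁ h₂ h₃ : G}
    (hh₀ : h₀ ∈ T) (hh₂ : h₂ ∈ T) (hh₁ : h₁ ∈ (T₀.1 \ T₁.1) \ T) (hh₃ : h₃ ∈ (T₀.1 \ T₁.1) \ T) (h02 : h₀ ≠ h₂) (h13 : h₁ ≠ h₃) :
    (∑ s ∈ T, Finsupp.single (oflipCM c hc2 s T₀) (1 : ℤ) - ∑ u ∈ (T₀.1 \ T₁.1) \ T, Finsupp.single (oflipCM c hc2 u T₁) (1 : ℤ) -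
        ((m : ℤ) - 1) • (Finsupp.single T₀ (1 : ℤ) - Finsupp.single T₁ 1)) -
      (∑ s ∈ (T \ {h₀, h₂}) ∪ {h₁, h₃}, Finsupp.single (oflipCM c hc2 s T₀) (1 : ℤ) -
        ∑ u ∈ (T₀.1 \ T₁.1) \ ((T \ {h₀, h₂}) ∪ {h₁, h₃}), Finsupp.single (oflipCM c hc2 u T₁) (1 : ℤ) -
        ((m : ℤ) - 1) • (Finsupp.single T₀ (1 : ℤ) - Finsupp.single T₁ 1)) =
      ((Finsupp.single (oflipCM c hc2 h₀ T₀) (1 : ℤ) - Finsupp.single T₀ 1) + (Finsupp.single (oflipCM c hc2 h₀ T₁) (1 : ℤ) - Finsupp.single T₁ 1)) -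
      ((Finsupp.single (oflipCM c hc2 h₁ T₀) (1 : ℤ) - Finsupp.single T₀ 1) + (Finsupp.single (oflipCM c hc2 h₁ T₁) (1 : ℤ) - Finsupp.single T₁ 1)) +
      ((Finsupp.single (oflipCM c hc2 h₂ T₀) (1 : ℤ) - Finsupp.single T₀ 1) + (Finsupp.single (oflipCM c hc2 h₂ T₁) (1 : ℤ) - Finsupp.single T₁ 1)) -
      ((Finsupp.single (oflipCM c hc2 h₃ T₀) (1 : ℤ) - Finsupp.single T₀ 1) + (Finsupp.single (oflipCM c hc2 h₃ T₁) (1 : ℤ) - Finsupp.single T₁ 1)) := by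
  set S := T \ {h₀, h₂} with hSdef
  have hsub : ({h₀, h₂} : Finset G) ⊆ T := by
    intro x hx; rw [mem_insert, mem_singleton] at hx; rcases hx with rfl | rfl <;> assumption
  have hT : T = S ∪ {h₀, h₂} := by rw [hSdef, sdiff_union_of_subset hsub]
  have hT'H : S ∪ {h₁, h₃} ⊆ T₀.1 \ T₁.1 := by
    refine union_subset (sdiff_subset.trans hTH) ?_
    intro x hx; rw [mem_insert, mem_singleton] at hx
    rcases hx with rfl | rfl
    · exact (mem_sdiff.mp hh₁).1
    · exact (mem_sdiff.mp hh₃).1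
  have hd1 : Disjoint S {h₀, h₂} := by rw [hSdef]; exact sdiff_disjoint
  have hd2 : Disjoint S {h₁, h₃} := by
    rw [hSdef, disjoint_iff_ne]; rintro x hx y hy rfl
    rw [mem_insert, mem_singleton] at hy
    have hxT : x ∈ T := (mem_sdiff.mp hx).1
    rcases hy with rfl | rfl
    · exact (mem_sdiff.mp hh₁).2 hxT
    · exact (mem_sdiff.mp hh₃).2 hxT
  -- `Σ_{𝓗∖S} = Σ_𝓗 − Σ_S`
  rw [sum_sdiff_eq_sub hTH, sum_sdiff_eq_sub hT'H]
  conv_lhs => rw [hT]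
  rw [sum_union hd1, sum_union hd1, sum_union hd2, sum_union hd2, sum_pair h02, sum_pair h02, sum_pair h13, sum_pair h13]
  abel

/-- **`Rᶜ(T') − Rᶜ(T'') = Y'_{k₀} − Y'_{k₁} + Y'_{k₂} − Y'_{k₃}`** for `T' ⊆ T₀ ∩ T₁` through `k₀ ≠ k₂` and `T'' = (T' ∖ {k₀, k₂}) ∪ {k₁, k₃}` with
`k₁ ≠ k₃` in `(T₀ ∩ T₁) ∖ T'` (`Rᶜ(S) = Σ_{s∈S} [T₀^{(s)}] + Σ_{u∈(T₀∩T₁)∖S} [T₁^{(u)}] − (m−1)(e₀ + e₁)`, `Y'_s = (f_s − e₀) − (g_s − e₁)`). [folklore] -/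
theorem relc_sub_relc_cycle (hc2 : c * c = 1) (T₀ T₁ : CMF G c) (m : ℕ) (T' : Finset G) (hTH : T' ⊆ T₀.1 ∩ T₁.1) {k₀ k₁ k₂ k₃ : G}
    (hk₀ : k₀ ∈ T') (hk₂ : k₂ ∈ T') (hk₁ : k₁ ∈ (T₀.1 ∩ T₁.1) \ T') (hk₃ : k₃ ∈ (T₀.1 ∩ T₁.1) \ T') (h02 : k₀ ≠ k₂) (h13 : k₁ ≠ k₃) :
    (∑ s ∈ T', Finsupp.single (oflipCM c hc2 s T₀) (1 : ℤ) + ∑ u ∈ (T₀.1 ∩ T₁.1) \ T', Finsupp.single (oflipCM c hc2 u T₁) (1 : ℤ) -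
        ((m : ℤ) - 1) • (Finsupp.single T₀ (1 : ℤ) + Finsupp.single T₁ 1)) -
      (∑ s ∈ (T' \ {k₀, k₂}) ∪ {k₁, k₃}, Finsupp.single (oflipCM c hc2 s T₀) (1 : ℤ) +
        ∑ u ∈ (T₀.1 ∩ T₁.1) \ ((T' \ {k₀, k₂}) ∪ {k₁, k₃}), Finsupp.single (oflipCM c hc2 u T₁) (1 : ℤ) -
        ((m : ℤ) - 1) • (Finsupp.single T₀ (1 : ℤ) + Finsupp.single T₁ 1)) =
      ((Finsupp.single (oflipCM c hc2 k₀ T₀) (1 : ℤ) - Finsupp.single T₀ 1) - (Finsupp.single (oflipCM c hc2 k₀ T₁) (1 : ℤ) - Finsupp.single T₁ 1)) -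
      ((Finsupp.single (oflipCM c hc2 k₁ T₀) (1 : ℤ) - Finsupp.single T₀ 1) - (Finsupp.single (oflipCM c hc2 k₁ T₁) (1 : ℤ) - Finsupp.single T₁ 1)) +
      ((Finsupp.single (oflipCM c hc2 k₂ T₀) (1 : ℤ) - Finsupp.single T₀ 1) - (Finsupp.single (oflipCM c hc2 k₂ T₁) (1 : ℤ) - Finsupp.single T₁ 1)) -
      ((Finsupp.single (oflipCM c hc2 k₃ T₀) (1 : ℤ) - Finsupp.single T₀ 1) - (Finsupp.single (oflipCM c hc2 k₃ T₁) (1 : ℤ) - Finsupp.single T₁ 1)) := by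
  set S := T' \ {k₀, k₂} with hSdef
  have hsub : ({k₀, k₂} : Finset G) ⊆ T' := by
    intro x hx; rw [mem_insert, mem_singleton] at hx; rcases hx with rfl | rfl <;> assumption
  have hT : T' = S ∪ {k₀, k₂} := by rw [hSdef, sdiff_union_of_subset hsub]
  have hT'H : S ∪ {k₁, k₃} ⊆ T₀.1 ∩ T₁.1 := by
    refine union_subset (sdiff_subset.trans hTH) ?_
    intro x hx; rw [mem_insert, mem_singleton] at hx
    rcases hx with rfl | rfl
    · exact (mem_sdiff.mp hk₁).1
    · exact (mem_sdiff.mp hk₃).1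
  have hd1 : Disjoint S {k₀, k₂} := by rw [hSdef]; exact sdiff_disjoint
  have hd2 : Disjoint S {k₁, k₃} := by
    rw [hSdef, disjoint_iff_ne]; rintro x hx y hy rfl
    rw [mem_insert, mem_singleton] at hy
    have hxT : x ∈ T' := (mem_sdiff.mp hx).1
    rcases hy with rfl | rfl
    · exact (mem_sdiff.mp hk₁).2 hxT
    · exact (mem_sdiff.mp hk₃).2 hxT
  rw [sum_sdiff_eq_sub hTH, sum_sdiff_eq_sub hT'H]
  conv_lhs => rw [hT]
  rw [sum_union hd1, sum_union hd1, sum_union hd2, sum_union hd2, sum_pair h02, sum_pair h02, sum_pair h13, sum_pair h13]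
  abel

/-! ## §3 A transversal swapped along a cycle is a transversal -/

/-- **Unique preimages of the place permutation on representatives**: if `t, h ∈ T₀` and the same `t'` represents the places of `t·Q` and of `h·Q`,
then `t = h`. [folklore] -/
theorem eq_of_swap_rel_eq (hc2 : c * c = 1) (T₀ : CMF G c) (Q : G) {t h t' : G} (ht : t ∈ T₀.1) (hh : h ∈ T₀.1)
    (h1 : t' = t * Q ∨ t' = c * (t * Q)) (h2 : t' = h * Q ∨ t' = c * (h * Q)) : t = h := by
  have key : t * Q = h * Q ∨ t * Q = c * (h * Q) := by
    rcases h1 with h1 | h1 <;> rcases h2 with h2 | h2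
    · exact Or.inl (h1.symm.trans h2)
    · exact Or.inr (h1.symm.trans h2)
    · right
      have e : t * Q = c * t' := by rw [h1, cmul_cmul c hc2]
      rw [e, h2]
    · left
      have e : t * Q = c * t' := by rw [h1, cmul_cmul c hc2]
      rw [e, h2, cmul_cmul c hc2]
  rcases key with e | e
  · exact mul_right_cancel e
  · rw [← mul_assoc] at e
    have e' : t = c * h := mul_right_cancel e
    exact absurd (e' ▸ ht) ((T₀.2 h).mp hh)

/-- Two representatives in `T₀` of the same place coincide. [folklore] -/
theorem rep_eq_of_rel (T₀ : CMF G c) {x y z : G} (hx : x ∈ T₀.1) (hy : y ∈ T₀.1) (h1 : x = z ∨ x = c * z) (h2 : y = z ∨ y = c * z) :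
    x = y := by
  rcases h1 with rfl | rfl <;> rcases h2 with h | h
  · exact h.symm
  · exact absurd (h ▸ hy) ((T₀.2 x).mp hx)
  · subst h; exact absurd hx ((T₀.2 y).mp hy)
  · exact h.symm

/-- **A TRANSVERSAL SWAPPED ALONG A CYCLE IS A TRANSVERSAL.**  `H ⊆ T₀` an ambient set of places, `T ⊆ H` a transversal of the place permutation of
`Q` on `H` (`t ∈ T ↔ σt ∉ T`), and a cycle `h₀ → h₁ → h₂ → h₃ → h₀` of that permutation inside `H` (on `T₀`-representatives) with `h₀, h₂ ∈ T`,
`h₀ ≠ h₂`, `h₁ ≠ h₃`.  Then `h₁, h₃ ∈ H ∖ T` and `(T ∖ {h₀, h₂}) ∪ {h₁, h₃}` is again a transversal on `H`, inside `H`, of the same size. [folklore] -/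
theorem transversal_cycle_swap (hc2 : c * c = 1) (T₀ : CMF G c) (Q : G) (H T : Finset G) (hHT₀ : H ⊆ T₀.1) (hTH : T ⊆ H)
    (hT : ∀ t ∈ H, ∀ t' ∈ T₀.1, (t' = t * Q ∨ t' = c * (t * Q)) → (t ∈ T ↔ t' ∉ T))
    {h₀ h₁ h₂ h₃ : G} (hh₀ : h₀ ∈ H) (hh₁ : h₁ ∈ H) (hh₂ : h₂ ∈ H) (hh₃ : h₃ ∈ H)
    (r₀ : h₁ = h₀ * Q ∨ h₁ = c * (h₀ * Q)) (r₁ : h₂ = h₁ * Q ∨ h₂ = c * (h₁ * Q)) (r₂ : h₃ = h₂ * Q ∨ h₃ = c * (h₂ * Q))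
    (r₃ : h₀ = h₃ * Q ∨ h₀ = c * (h₃ * Q)) (hh₀T : h₀ ∈ T) (hh₂T : h₂ ∈ T) (h02 : h₀ ≠ h₂) (h13 : h₁ ≠ h₃) :
    h₁ ∈ H \ T ∧ h₃ ∈ H \ T ∧ (T \ {h₀, h₂}) ∪ {h₁, h₃} ⊆ H ∧ ((T \ {h₀, h₂}) ∪ {h₁, h₃}).card = T.card ∧
      ∀ t ∈ H, ∀ t' ∈ T₀.1, (t' = t * Q ∨ t' = c * (t * Q)) → (t ∈ (T \ {h₀, h₂}) ∪ {h₁, h₃} ↔ t' ∉ (T \ {h₀, h₂}) ∪ {h₁, h₃}) := by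
  have hh₁T : h₁ ∉ T := (hT h₀ hh₀ h₁ (hHT₀ hh₁) r₀).mp hh₀T
  have hh₃T : h₃ ∉ T := (hT h₂ hh₂ h₃ (hHT₀ hh₃) r₂).mp hh₂T
  have h01 : h₀ ≠ h₁ := fun h => hh₁T (h ▸ hh₀T)
  have h03 : h₀ ≠ h₃ := fun h => hh₃T (h ▸ hh₀T)
  have h21 : h₂ ≠ h₁ := fun h => hh₁T (h ▸ hh₂T)
  have h23 : h₂ ≠ h₃ := fun h => hh₃T (h ▸ hh₂T)
  have hsub : ({h₀, h₂} : Finset G) ⊆ T := by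
    intro x hx; rw [mem_insert, mem_singleton] at hx; rcases hx with rfl | rfl <;> assumption
  refine ⟨mem_sdiff.mpr ⟨hh₁, hh₁T⟩, mem_sdiff.mpr ⟨hh₃, hh₃T⟩, ?_, ?_, ?_⟩
  · refine union_subset (sdiff_subset.trans hTH) ?_
    intro x hx; rw [mem_insert, mem_singleton] at hx; rcases hx with rfl | rfl <;> assumption
  · have hd : Disjoint (T \ {h₀, h₂}) {h₁, h₃} := by
      rw [disjoint_iff_ne]; rintro x hx y hy rfl
      rw [mem_insert, mem_singleton] at hy
      have hxT : x ∈ T := (mem_sdiff.mp hx).1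
      rcases hy with rfl | rfl
      · exact hh₁T hxT
      · exact hh₃T hxT
    rw [card_union_of_disjoint hd, card_sdiff_of_subset hsub, card_pair h02, card_pair h13]
    have : 2 ≤ T.card := by rw [← card_pair h02]; exact card_le_card hsub
    omega
  · -- transversality
    intro t ht t' ht' hrel
    have memT' : ∀ x : G, x ∈ (T \ {h₀, h₂}) ∪ {h₁, h₃} ↔ (x ∈ T ∧ x ≠ h₀ ∧ x ≠ h₂) ∨ (x = h₁ ∨ x = h₃) := fun x => by
      rw [mem_union, mem_sdiff, mem_insert, mem_singleton, mem_insert, mem_singleton, not_or]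
    by_cases htC : t = h₀ ∨ t = h₁ ∨ t = h₂ ∨ t = h₃
    · -- on the cycle: `t'` is the next element
      rcases htC with hti | hti | hti | hti <;> rw [hti] at hrel ⊢
      · have e : t' = h₁ := rep_eq_of_rel c T₀ ht' (hHT₀ hh₁) hrel r₀
        rw [e, memT', memT']
        constructor
        · rintro (⟨-, h, -⟩ | h | h)
          · exact absurd rfl h
          · exact absurd h h01
          · exact absurd h h03
        · intro h; exact absurd (Or.inr (Or.inl rfl)) h
      · have e : t' = h₂ := rep_eq_of_rel c T₀ ht' (hHT₀ hh₂) hrel r₁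
        rw [e, memT', memT']
        constructor
        · intro _
          rintro (⟨-, -, h⟩ | h | h)
          · exact h rfl
          · exact h21 h
          · exact h23 h
        · intro _; exact Or.inr (Or.inl rfl)
      · have e : t' = h₃ := rep_eq_of_rel c T₀ ht' (hHT₀ hh₃) hrel r₂
        rw [e, memT', memT']
        constructor
        · rintro (⟨-, -, h⟩ | h | h)
          · exact absurd rfl h
          · exact absurd h h21
          · exact absurd h h23
        · intro h; exact absurd (Or.inr (Or.inr rfl)) h
      · have e : t' = h₀ := rep_eq_of_rel c T₀ ht' (hHT₀ hh₀) hrel r₃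
        rw [e, memT', memT']
        constructor
        · intro _
          rintro (⟨-, h, -⟩ | h | h)
          · exact h rfl
          · exact h01 h
          · exact h03 h
        · intro _; exact Or.inr (Or.inr rfl)
    · -- off the cycle: `t'` is off the cycle too, and membership is that of `T`
      rw [not_or, not_or, not_or] at htC
      obtain ⟨ht0, ht1, ht2, ht3⟩ := htC
      have ht'C : t' ≠ h₀ ∧ t' ≠ h₁ ∧ t' ≠ h₂ ∧ t' ≠ h₃ := by
        refine ⟨fun e => ht3 ?_, fun e => ht0 ?_, fun e => ht1 ?_, fun e => ht2 ?_⟩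
        · exact eq_of_swap_rel_eq c hc2 T₀ Q (hHT₀ ht) (hHT₀ hh₃) hrel (e ▸ r₃)
        · exact eq_of_swap_rel_eq c hc2 T₀ Q (hHT₀ ht) (hHT₀ hh₀) hrel (e ▸ r₀)
        · exact eq_of_swap_rel_eq c hc2 T₀ Q (hHT₀ ht) (hHT₀ hh₁) hrel (e ▸ r₁)
        · exact eq_of_swap_rel_eq c hc2 T₀ Q (hHT₀ ht) (hHT₀ hh₂) hrel (e ▸ r₂)
      obtain ⟨ht'0, ht'1, ht'2, ht'3⟩ := ht'C
      have key := hT t ht t' ht' hrel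
      rw [memT', memT']
      constructor
      · rintro (⟨htT, -, -⟩ | h | h)
        · intro h'
          rcases h' with ⟨ht'T, -, -⟩ | h' | h'
          · exact (key.mp htT) ht'T
          · exact ht'1 h'
          · exact ht'3 h'
        · exact absurd h ht1
        · exact absurd h ht3
      · intro h
        left
        refine ⟨?_, ht0, ht2⟩
        by_contra htT
        have ht'T : t' ∈ T := by by_contra h'; exact htT (key.mpr h')
        exact h (Or.inl ⟨ht'T, ht'0, ht'2⟩)

/-! ## §4 `4Y_h` and `4Y'_k` from the transversal relations and the consecutive sums -/

/-- **`4Y_{h₀} ∈ L` ON A CYCLE OF `𝓗`.**  If `L` contains `R(T)` for every transversal `T ⊆ 𝓗 = T₀ ∖ T₁` of the swap `Q` with `|T| = m`, some such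
transversal exists, `h₀ → h₁ → h₂ → h₃ → h₀` is a cycle of the place permutation of `Q` inside `𝓗` (`h₀ ≠ h₂`, `h₁ ≠ h₃`), and `L` contains the
consecutive sums `Y_{h₀} + Y_{h₁}`, `Y_{h₁} + Y_{h₂}`, `Y_{h₂} + Y_{h₃}`, then `4Y_{h₀} ∈ L` (`Y_s = (f_s − e₀) + (g_s − e₁)`). [folklore] -/
theorem four_smul_Y_mem_of_cycle (hc2 : c * c = 1) (T₀ T₁ : CMF G c) (m : ℕ) (Q : G) (L : Submodule ℤ (CMF G c →₀ ℤ))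
    (hR : ∀ T : Finset G, T ⊆ T₀.1 \ T₁.1 → T.card = m →
      (∀ t ∈ T₀.1 \ T₁.1, ∀ t' ∈ T₀.1, (t' = t * Q ∨ t' = c * (t * Q)) → (t ∈ T ↔ t' ∉ T)) →
      ∑ s ∈ T, Finsupp.single (oflipCM c hc2 s T₀) (1 : ℤ) - ∑ u ∈ (T₀.1 \ T₁.1) \ T, Finsupp.single (oflipCM c hc2 u T₁) (1 : ℤ) -
        ((m : ℤ) - 1) • (Finsupp.single T₀ (1 : ℤ) - Finsupp.single T₁ 1) ∈ L)
    (hT : ∃ T : Finset G, T ⊆ T₀.1 \ T₁.1 ∧ T.card = m ∧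
      ∀ t ∈ T₀.1 \ T₁.1, ∀ t' ∈ T₀.1, (t' = t * Q ∨ t' = c * (t * Q)) → (t ∈ T ↔ t' ∉ T))
    {h₀ h₁ h₂ h₃ : G} (hh₀ : h₀ ∈ T₀.1 \ T₁.1) (hh₁ : h₁ ∈ T₀.1 \ T₁.1) (hh₂ : h₂ ∈ T₀.1 \ T₁.1) (hh₃ : h₃ ∈ T₀.1 \ T₁.1)
    (r₀ : h₁ = h₀ * Q ∨ h₁ = c * (h₀ * Q)) (r₁ : h₂ = h₁ * Q ∨ h₂ = c * (h₁ * Q)) (r₂ : h₃ = h₂ * Q ∨ h₃ = c * (h₂ * Q))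
    (r₃ : h₀ = h₃ * Q ∨ h₀ = c * (h₃ * Q)) (h02 : h₀ ≠ h₂) (h13 : h₁ ≠ h₃)
    (hP01 : ((Finsupp.single (oflipCM c hc2 h₀ T₀) (1 : ℤ) - Finsupp.single T₀ 1) + (Finsupp.single (oflipCM c hc2 h₀ T₁) (1 : ℤ) - Finsupp.single T₁ 1)) + ((Finsupp.single (oflipCM c hc2 h₁ T₀) (1 : ℤ) - Finsupp.single T₀ 1) + (Finsupp.single (oflipCM c hc2 h₁ T₁) (1 : ℤ) - Finsupp.single T₁ 1)) ∈ L) (hP12 : ((Finsupp.single (oflipCM c hc2 h₁ T₀) (1 : ℤ) - Finsupp.single T₀ 1) + (Finsupp.single (oflipCM c hc2 h₁ T₁) (1 : ℤ) - Finsupp.single T₁ 1)) + ((Finsupp.single (oflipCM c hc2 h₂ T₀) (1 : ℤ) - Finsupp.single T₀ 1) + (Finsupp.single (oflipCM c hc2 h₂ T₁) (1 : ℤ) - Finsupp.single T₁ 1)) ∈ L) (hP23 : ((Finsupp.single (oflipCM c hc2 h₂ T₀) (1 : ℤ) - Finsupp.single T₀ 1) + (Finsupp.single (oflipCM c hc2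 h₂ T₁) (1 : ℤ) - Finsupp.single T₁ 1)) + ((Finsupp.single (oflipCM c hc2 h₃ T₀) (1 : ℤ) - Finsupp.single T₀ 1) + (Finsupp.single (oflipCM c hc2 h₃ T₁) (1 : ℤ) - Finsupp.single T₁ 1)) ∈ L) :
    (4 : ℤ) • ((Finsupp.single (oflipCM c hc2 h₀ T₀) (1 : ℤ) - Finsupp.single T₀ 1) + (Finsupp.single (oflipCM c hc2 h₀ T₁) (1 : ℤ) - Finsupp.single T₁ 1)) ∈ L := by
  obtain ⟨T, hTH, hTm, hTt⟩ := hT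
  have hHT₀ : T₀.1 \ T₁.1 ⊆ T₀.1 := sdiff_subset
  refine four_smul_mem_of_consecutive L hP01 hP12 hP23 ?_
  by_cases hh₀T : h₀ ∈ T
  · have hh₁T : h₁ ∉ T := (hTt h₀ hh₀ h₁ (hHT₀ hh₁) r₀).mp hh₀T
    have hh₂T : h₂ ∈ T := by by_contra h; exact hh₁T ((hTt h₁ hh₁ h₂ (hHT₀ hh₂) r₁).mpr h)
    obtain ⟨hh₁', hh₃', hT'H, hT'c, hT't⟩ := transversal_cycle_swap c hc2 T₀ Q (T₀.1 \ T₁.1) T hHT₀ hTH hTt hh₀ hh₁ hh₂ hh₃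
      r₀ r₁ r₂ r₃ hh₀T hh₂T h02 h13
    have h := Submodule.sub_mem _ (hR T hTH hTm hTt) (hR _ hT'H (hT'c.trans hTm) hT't)
    rwa [rel_sub_rel_cycle c hc2 T₀ T₁ m T hTH hh₀T hh₂T hh₁' hh₃' h02 h13] at h
  · have hh₁T : h₁ ∈ T := by by_contra h; exact hh₀T ((hTt h₀ hh₀ h₁ (hHT₀ hh₁) r₀).mpr h)
    have hh₂T : h₂ ∉ T := (hTt h₁ hh₁ h₂ (hHT₀ hh₂) r₁).mp hh₁T
    have hh₃T : h₃ ∈ T := by by_contra h; exact hh₂T ((hTt h₂ hh₂ h₃ (hHT₀ hh₃) r₂).mpr h)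
    obtain ⟨hh₂', hh₀', hT'H, hT'c, hT't⟩ := transversal_cycle_swap c hc2 T₀ Q (T₀.1 \ T₁.1) T hHT₀ hTH hTt hh₁ hh₂ hh₃ hh₀
      r₁ r₂ r₃ r₀ hh₁T hh₃T h13 h02.symm
    have h := Submodule.sub_mem _ (hR T hTH hTm hTt) (hR _ hT'H (hT'c.trans hTm) hT't)
    rw [rel_sub_rel_cycle c hc2 T₀ T₁ m T hTH hh₁T hh₃T hh₂' hh₀' h13 h02.symm] at h
    have h' := Submodule.neg_mem _ h
    convert h' using 1; abel

/-- **`4Y'_{k₀} ∈ L` ON A CYCLE OF `T₀ ∩ T₁`.**  If `L` contains `Rᶜ(T')` for every transversal `T' ⊆ T₀ ∩ T₁` of the swap `Q` with `|T'| = m`,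
some such transversal exists, `k₀ → k₁ → k₂ → k₃ → k₀` is a cycle of the place permutation of `Q` inside `T₀ ∩ T₁` (`k₀ ≠ k₂`, `k₁ ≠ k₃`), and `L`
contains the consecutive sums `Y'_{k₀} + Y'_{k₁}`, `Y'_{k₁} + Y'_{k₂}`, `Y'_{k₂} + Y'_{k₃}`, then `4Y'_{k₀} ∈ L`
(`Y'_s = (f_s − e₀) − (g_s − e₁)`). [folklore] -/
theorem four_smul_Y'_mem_of_cycle (hc2 : c * c = 1) (T₀ T₁ : CMF G c) (m : ℕ) (Q : G) (L : Submodule ℤ (CMF G c →₀ ℤ))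
    (hRc : ∀ T' : Finset G, T' ⊆ T₀.1 ∩ T₁.1 → T'.card = m →
      (∀ t ∈ T₀.1 ∩ T₁.1, ∀ t' ∈ T₀.1, (t' = t * Q ∨ t' = c * (t * Q)) → (t ∈ T' ↔ t' ∉ T')) →
      ∑ s ∈ T', Finsupp.single (oflipCM c hc2 s T₀) (1 : ℤ) + ∑ u ∈ (T₀.1 ∩ T₁.1) \ T', Finsupp.single (oflipCM c hc2 u T₁) (1 : ℤ) -
        ((m : ℤ) - 1) • (Finsupp.single T₀ (1 : ℤ) + Finsupp.single T₁ 1) ∈ L)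
    (hT' : ∃ T' : Finset G, T' ⊆ T₀.1 ∩ T₁.1 ∧ T'.card = m ∧
      ∀ t ∈ T₀.1 ∩ T₁.1, ∀ t' ∈ T₀.1, (t' = t * Q ∨ t' = c * (t * Q)) → (t ∈ T' ↔ t' ∉ T'))
    {k₀ k₁ k₂ k₃ : G} (hk₀ : k₀ ∈ T₀.1 ∩ T₁.1) (hk₁ : k₁ ∈ T₀.1 ∩ T₁.1) (hk₂ : k₂ ∈ T₀.1 ∩ T₁.1) (hk₃ : k₃ ∈ T₀.1 ∩ T₁.1)
    (r₀ : k₁ = k₀ * Q ∨ k₁ = c * (k₀ * Q)) (r₁ : k₂ = k₁ * Q ∨ k₂ = c * (k₁ * Q)) (r₂ : k₃ = k₂ * Q ∨ k₃ = c * (k₂ * Q))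
    (r₃ : k₀ = k₃ * Q ∨ k₀ = c * (k₃ * Q)) (h02 : k₀ ≠ k₂) (h13 : k₁ ≠ k₃)
    (hP01 : ((Finsupp.single (oflipCM c hc2 k₀ T₀) (1 : ℤ) - Finsupp.single T₀ 1) - (Finsupp.single (oflipCM c hc2 k₀ T₁) (1 : ℤ) - Finsupp.single T₁ 1)) + ((Finsupp.single (oflipCM c hc2 k₁ T₀) (1 : ℤ) - Finsupp.single T₀ 1) - (Finsupp.single (oflipCM c hc2 k₁ T₁) (1 : ℤ) - Finsupp.single T₁ 1)) ∈ L) (hP12 : ((Finsupp.single (oflipCM c hc2 k₁ T₀) (1 : ℤ) - Finsupp.single T₀ 1) - (Finsupp.single (oflipCM c hc2 k₁ T₁) (1 : ℤ) - Finsupp.single T₁ 1)) + ((Finsupp.single (oflipCM c hc2 k₂ T₀) (1 : ℤ) - Finsupp.single T₀ 1) - (Finsupp.single (oflipCM c hc2 k₂ T₁) (1 : ℤ) - Finsupp.single T₁ 1)) ∈ L) (hP23 : ((Finsupp.single (oflipCM c hc2 k₂ T₀) (1 : ℤ) - Finsupp.single T₀ 1) - (Finsupp.single (oflipCM c hc2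 k₂ T₁) (1 : ℤ) - Finsupp.single T₁ 1)) + ((Finsupp.single (oflipCM c hc2 k₃ T₀) (1 : ℤ) - Finsupp.single T₀ 1) - (Finsupp.single (oflipCM c hc2 k₃ T₁) (1 : ℤ) - Finsupp.single T₁ 1)) ∈ L) :
    (4 : ℤ) • ((Finsupp.single (oflipCM c hc2 k₀ T₀) (1 : ℤ) - Finsupp.single T₀ 1) - (Finsupp.single (oflipCM c hc2 k₀ T₁) (1 : ℤ) - Finsupp.single T₁ 1)) ∈ L := by
  obtain ⟨T, hTH, hTm, hTt⟩ := hT'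
  have hHT₀ : T₀.1 ∩ T₁.1 ⊆ T₀.1 := inter_subset_left
  refine four_smul_mem_of_consecutive L hP01 hP12 hP23 ?_
  by_cases hk₀T : k₀ ∈ T
  · have hk₁T : k₁ ∉ T := (hTt k₀ hk₀ k₁ (hHT₀ hk₁) r₀).mp hk₀T
    have hk₂T : k₂ ∈ T := by by_contra h; exact hk₁T ((hTt k₁ hk₁ k₂ (hHT₀ hk₂) r₁).mpr h)
    obtain ⟨hk₁', hk₃', hT'H, hT'c, hT't⟩ := transversal_cycle_swap c hc2 T₀ Q (T₀.1 ∩ T₁.1) T hHT₀ hTH hTt hk₀ hk₁ hk₂ hk₃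
      r₀ r₁ r₂ r₃ hk₀T hk₂T h02 h13
    have h := Submodule.sub_mem _ (hRc T hTH hTm hTt) (hRc _ hT'H (hT'c.trans hTm) hT't)
    rwa [relc_sub_relc_cycle c hc2 T₀ T₁ m T hTH hk₀T hk₂T hk₁' hk₃' h02 h13] at h
  · have hk₁T : k₁ ∈ T := by by_contra h; exact hk₀T ((hTt k₀ hk₀ k₁ (hHT₀ hk₁) r₀).mpr h)
    have hk₂T : k₂ ∉ T := (hTt k₁ hk₁ k₂ (hHT₀ hk₂) r₁).mp hk₁T
    have hk₃T : k₃ ∈ T := by by_contra h; exact hk₂T ((hTt k₂ hk₂ k₃ (hHT₀ hk₃) r₂).mpr h)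
    obtain ⟨hk₂', hk₀', hT'H, hT'c, hT't⟩ := transversal_cycle_swap c hc2 T₀ Q (T₀.1 ∩ T₁.1) T hHT₀ hTH hTt hk₁ hk₂ hk₃ hk₀
      r₁ r₂ r₃ r₀ hk₁T hk₃T h13 h02.symm
    have h := Submodule.sub_mem _ (hRc T hTH hTm hTt) (hRc _ hT'H (hT'c.trans hTm) hT't)
    rw [relc_sub_relc_cycle c hc2 T₀ T₁ m T hTH hk₁T hk₃T hk₂' hk₀' h13 h02.symm] at h
    have h' := Submodule.neg_mem _ h
    convert h' using 1; abel

end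

end Summit.HodgeConjecture.CorCM.Census.CentralSquares
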